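import Literature.NumberTheory.EllipticCurves.Jetchev2008.SelmerStructures
import HarnessLib

/-!
# T1 JET (cell `bsd-jet`), road K, stub S2: kernel companions of the [J] §3.3–3.4 Selmer-structure
# vocabulary (`Literature/…/Jetchev2008/SelmerStructures.lean`, p486185) and its RECONCILIATION with
# the sibling's Selmer module (`Jetchev2008/CoreVertices.lean`, p485508)

HONEST FRAMING (programme file §HONESTY, verbatim): «no tranche here proves BSD; ARM L moves the
LITERAL column of an r ≤ 1 census into the kernel-proved-modulo-named-print column.» THEOREMS ONLY
(seat `bsd-jet-pv-2`, session g2; `--supports stmt-BirchSwinnertonDyer-14418`, helper). The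
definitions `Jetchev2008.placesDividing`, `selmerF` (𝓕(c) as a `SelmerStructure`, transverse family
`𝒯` a parameter), `selmerF0` (𝓕_⌈q⌉(c), stringent family `𝒮` a parameter) landed statement-only;
this file gives (i) their unfolding lemmas place by place, (ii) the identification of the two
incidences «`v` lies over a prime factor of `c`» (`Jetchev2008.PlaceOver`, lit-ty) ↔
«`v ∈ placesDividing K c`», and (iii) the RECONCILIATION
`selmerGroup_selmerF_eq_modifiedSelmerGroup`: the Selmer group of the STRUCTURE
`selmerF W n 𝒯 (placesDividing K c)` equals lit-ty's subgroup-level `modifiedSelmerGroup W K ι n c`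
(on which the typed Prop. 5.3 `prop53_exists_coreVertex_of_depth_add_le_levelIndex` is stated) as
soon as the local family `𝒯` cuts out, at the places dividing `c`, the GLOBAL transverse conditions
`transverseKer` — the interface between the structure-level Poitou–Tate counting
(`JET.GlobalDuality.*`, pv-1) and the module-level fact. Elementary; 0 classes move.
References: [Jetchev2008] §3.1.2, §3.2.2, §3.3.1–3.3.2, §3.4.1 (pp. 814–816).
-/

noncomputable section


open scoped Classical

open WeierstrassCurve IsDedekindDomain NumberField
  Literature.NumberTheory.GaloisRepresentations
  Literature.NumberTheory.GaloisRepresentations.DiscreteGaloisModule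
  Literature.NumberTheory.EllipticCurves Literature.NumberTheory.EllipticCurves.Jetchev2008

namespace Summit.BirchSwinnertonDyer.Rank1Residual.JET.SelmerVocabulary

variable {K : Type} [Field K] [NumberField K] (W : WeierstrassCurve ℚ)

/-- Membership in `placesDividing K c` for `c ≠ 0`: `λ ∣ (c)`. [cite: Jetchev2008, §3.4.1 (p. 816)] -/
theorem mem_placesDividing_iff {c : ℕ} (hc : c ≠ 0) (v : HeightOneSpectrum (𝓞 K)) :
    v ∈ placesDividing K c ↔ v.asIdeal ∣ Ideal.span {(c : 𝓞 K)} := by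
  have h : Ideal.span {(c : 𝓞 K)} ≠ ⊥ := by
    rw [Ne, Ideal.span_singleton_eq_bot]
    exact_mod_cast hc
  simp [placesDividing, h]

/-- Membership in `placesDividing K c` for `c ≠ 0`, element form: `(c : 𝓞_K) ∈ 𝔭_λ`.
[cite: Jetchev2008, §3.4.1 (p. 816)] -/
theorem mem_placesDividing_iff_natCast_mem {c : ℕ} (hc : c ≠ 0) (v : HeightOneSpectrum (𝓞 K)) :
    v ∈ placesDividing K c ↔ (c : 𝓞 K) ∈ v.asIdeal := by
  rw [mem_placesDividing_iff hc, Ideal.dvd_span_singleton]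

/-- `placesDividing K 1 = ∅` (the conductor `1` modifies nothing). [cite: Jetchev2008, §3.4.1 (p. 816)] -/
@[simp] theorem placesDividing_one : placesDividing K 1 = ∅ := by
  ext v
  simp only [Finset.notMem_empty, iff_false]
  rw [mem_placesDividing_iff_natCast_mem one_ne_zero, Nat.cast_one]
  exact fun h ↦ v.isPrime.ne_top ((Ideal.eq_top_iff_one _).mpr h)

omit [NumberField K] in
/-- A prime `λ` of `K` contains `c ≠ 0` iff it contains some prime factor `ℓ` of `c`. Elementary.
[cite: Jetchev2008, §3.4.1 (p. 816)] -/
theorem natCast_mem_iff_exists_primeFactor_mem {c : ℕ} (hc : c ≠ 0) (v : HeightOneSpectrum (𝓞 K)) :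
    (c : 𝓞 K) ∈ v.asIdeal ↔ ∃ ℓ ∈ c.primeFactors, (ℓ : 𝓞 K) ∈ v.asIdeal := by
  constructor
  · intro h
    have hprod : (c : 𝓞 K) = ∏ ℓ ∈ c.primeFactors, (ℓ : 𝓞 K) ^ c.factorization ℓ := by
      conv_lhs => rw [← Nat.prod_factorization_pow_eq_self hc]
      rw [Finsupp.prod, Nat.support_factorization, Nat.cast_prod]
      simp only [Nat.cast_pow]
    rw [hprod, Ideal.IsPrime.prod_mem_iff] at h
    obtain ⟨ℓ, hℓ, hmem⟩ := h
    exact ⟨ℓ, hℓ, v.isPrime.mem_of_pow_mem _ hmem⟩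
  · rintro ⟨ℓ, hℓ, hmem⟩
    obtain ⟨d, hd⟩ := Nat.dvd_of_mem_primeFactors hℓ
    rw [hd, Nat.cast_mul]
    exact v.asIdeal.mul_mem_right _ hmem

/-- The two incidences agree: a place `v` of `K` lies over SOME prime factor of `c ≠ 0`
(`Jetchev2008.PlaceOver`, the sibling's) iff it is `Sum.inr λ` with `λ ∈ placesDividing K c`.
[cite: Jetchev2008, §3.4.1 (p. 816)] -/
theorem exists_placeOver_iff {c : ℕ} (hc : c ≠ 0) (v : Place K) :
    (∃ ℓ ∈ c.primeFactors, PlaceOver K v ℓ) ↔ ∃ w ∈ placesDividing K c, v = Sum.inr w := by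
  constructor
  · rintro ⟨ℓ, hℓ, w, rfl, hw⟩
    exact ⟨w, (mem_placesDividing_iff_natCast_mem hc w).mpr
      ((natCast_mem_iff_exists_primeFactor_mem hc w).mpr ⟨ℓ, hℓ, hw⟩), rfl⟩
  · rintro ⟨w, hw, rfl⟩
    obtain ⟨ℓ, hℓ, hmem⟩ := (natCast_mem_iff_exists_primeFactor_mem hc w).mp
      ((mem_placesDividing_iff_natCast_mem hc w).mp hw)
    exact ⟨ℓ, hℓ, w, rfl, hmem⟩

/-- `𝓕(1) = 𝓕` (no modification). [cite: Jetchev2008, §3.4.1 (p. 816)] -/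
@[simp] theorem selmerF_empty (n : ℤ) (𝒯 : SelmerStructure ((W.baseChange K).torsionGaloisModule n)) :
    selmerF W n 𝒯 ∅ = (W.baseChange K).kummerSelmerStructure n := by
  simp [selmerF, SelmerStructure.transverseAt]

/-- `𝓕(c)` at an infinite place: the Kummer condition (never modified).
[cite: Jetchev2008, §3.4.1 (p. 816)] -/
@[simp] theorem selmerF_inl (n : ℤ) (𝒯 : SelmerStructure ((W.baseChange K).torsionGaloisModule n))
    (S : Finset (HeightOneSpectrum (𝓞 K))) (w : InfinitePlace K) :
    selmerF W n 𝒯 S (Sum.inl w) = (W.baseChange K).kummerSelmerStructure n (Sum.inl w) := rfl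

/-- `𝓕(c)` at a finite place: transverse at `λ ∈ S`, Kummer elsewhere.
[cite: Jetchev2008, §3.4.1 (p. 816)] -/
theorem selmerF_inr (n : ℤ) (𝒯 : SelmerStructure ((W.baseChange K).torsionGaloisModule n))
    (S : Finset (HeightOneSpectrum (𝓞 K))) (v : HeightOneSpectrum (𝓞 K)) :
    selmerF W n 𝒯 S (Sum.inr v) =
      if v ∈ S then 𝒯 (Sum.inr v) else (W.baseChange K).kummerSelmerStructure n (Sum.inr v) := by
  simp [selmerF, SelmerStructure.transverseAt, SelmerStructure.modify_inr]

/-- `𝓕_⌈q⌉(c)` at a finite place: stringent at `v ∈ Q`, else as `𝓕(c)`.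
[cite: Jetchev2008, §3.3.2 (p. 816)] -/
theorem selmerF0_inr (n : ℤ) (𝒯 𝒮 : SelmerStructure ((W.baseChange K).torsionGaloisModule n))
    (S Q : Finset (HeightOneSpectrum (𝓞 K))) (v : HeightOneSpectrum (𝓞 K)) :
    selmerF0 W n 𝒯 𝒮 S Q (Sum.inr v) =
      if v ∈ Q then 𝒮 (Sum.inr v) else selmerF W n 𝒯 S (Sum.inr v) := by
  simp [selmerF0, SelmerStructure.modify_inr]

/-- `𝓕_⌈q⌉(c)` at an infinite place: as `𝓕(c)`. [cite: Jetchev2008, §3.3.2 (p. 816)] -/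
@[simp] theorem selmerF0_inl (n : ℤ) (𝒯 𝒮 : SelmerStructure ((W.baseChange K).torsionGaloisModule n))
    (S Q : Finset (HeightOneSpectrum (𝓞 K))) (w : InfinitePlace K) :
    selmerF0 W n 𝒯 𝒮 S Q (Sum.inl w) = selmerF W n 𝒯 S (Sum.inl w) := rfl

/-- `𝓕_⌈q⌉(c)` with no stringent place is `𝓕(c)`. [cite: Jetchev2008, §3.3.2 (p. 816)] -/
@[simp] theorem selmerF0_empty (n : ℤ) (𝒯 𝒮 : SelmerStructure ((W.baseChange K).torsionGaloisModule n))
    (S : Finset (HeightOneSpectrum (𝓞 K))) : selmerF0 W n 𝒯 𝒮 S ∅ = selmerF W n 𝒯 S := by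
  simp [selmerF0]

/-- **Membership in the Selmer group of the STRUCTURE `𝓕(c)`** (`c ≠ 0`): the Kummer condition at
every place not above a prime factor of `c` (in the sibling's `PlaceOver` wording) and the local
condition `𝒯` at the places dividing `c`. [cite: Jetchev2008, §3.2.2 and §3.4.1 (pp. 815–816)] -/
theorem mem_selmerGroup_selmerF_iff (n : ℤ) (𝒯 : SelmerStructure ((W.baseChange K).torsionGaloisModule n))
    {c : ℕ} (hc : c ≠ 0) (x : galoisCohomology ((W.baseChange K).torsionGaloisModule n) 1) :
    x ∈ (selmerF W n 𝒯 (placesDividing K c)).selmerGroup ↔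
      (∀ v : Place K, (∀ ℓ ∈ c.primeFactors, ¬ PlaceOver K v ℓ) →
        galoisCohomology.localization ((W.baseChange K).torsionGaloisModule n) v 1 x ∈
          (W.baseChange K).kummerSelmerStructure n v) ∧
      (∀ w ∈ placesDividing K c,
        galoisCohomology.localization ((W.baseChange K).torsionGaloisModule n) (Sum.inr w) 1 x ∈
          𝒯 (Sum.inr w)) := by
  rw [SelmerStructure.mem_selmerGroup_iff]
  constructor
  · intro h
    refine ⟨fun v hv ↦ ?_, fun w hw ↦ ?_⟩
    · rcases v with w | v
      · simpa using h (Sum.inl w)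
      · have hvS : v ∉ placesDividing K c := by
          intro hvS
          obtain ⟨ℓ, hℓ, hP⟩ := (exists_placeOver_iff hc (Sum.inr v)).mpr ⟨v, hvS, rfl⟩
          exact hv ℓ hℓ hP
        simpa [selmerF_inr, hvS] using h (Sum.inr v)
    · simpa [selmerF_inr, hw] using h (Sum.inr w)
  · rintro ⟨hK, hT⟩ v
    rcases v with w | v
    · simpa using hK (Sum.inl w) (fun ℓ _ ⟨_, h, _⟩ ↦ by cases h)
    · by_cases hvS : v ∈ placesDividing K c
      · simpa [selmerF_inr, hvS] using hT v hvS
      · have hv : ∀ ℓ ∈ c.primeFactors, ¬ PlaceOver K (Sum.inr v) ℓ := by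
          intro ℓ hℓ hP
          obtain ⟨w, hw, hvw⟩ := (exists_placeOver_iff hc (Sum.inr v)).mp ⟨ℓ, hℓ, hP⟩
          cases hvw
          exact hvS hw
        simpa [selmerF_inr, hvS] using hK (Sum.inr v) hv

/-- **RECONCILIATION with the sibling's Selmer MODULE** (`Jetchev2008.modifiedSelmerGroup`, the
subgroup `H_{𝓕(c)}` with the GLOBAL transverse condition `transverseKer`): if the local family `𝒯`
cuts out, at the places dividing `c`, exactly the sibling's global transverse conditions at the
prime factors of `c` — the compatibility printed §3.1.2 asserts for `𝒯 = H¹_tr(K_λ, ·)` — then the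
Selmer group of the STRUCTURE `selmerF W n 𝒯 (placesDividing K c)` IS `modifiedSelmerGroup W K ι n c`.
This is the interface between the structure-level duality (`JET.GlobalDuality.*`) and the typed
Prop. 5.3 (`prop53_exists_coreVertex_of_depth_add_le_levelIndex`, stated on `modifiedSelmerGroup`).
[cite: Jetchev2008, §3.1.2 (p. 814), §3.4.1 (p. 816)] -/
theorem selmerGroup_selmerF_eq_modifiedSelmerGroup (ι : K →+* ℂ)
    [∀ k : ℕ, NumberField (ringClassField K ι k)] (n : ℤ)
    (𝒯 : SelmerStructure ((W.baseChange K).torsionGaloisModule n)) {c : ℕ} (hc : c ≠ 0)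
    (hcompat : ∀ x : galoisCohomology ((W.baseChange K).torsionGaloisModule n) 1,
      (∀ w ∈ placesDividing K c,
        galoisCohomology.localization ((W.baseChange K).torsionGaloisModule n) (Sum.inr w) 1 x ∈
          𝒯 (Sum.inr w)) ↔ ∀ ℓ ∈ c.primeFactors, x ∈ transverseKer W K ι n ℓ) :
    (selmerF W n 𝒯 (placesDividing K c)).selmerGroup = modifiedSelmerGroup W K ι n c := by
  ext x
  rw [mem_selmerGroup_selmerF_iff W n 𝒯 hc, mem_modifiedSelmerGroup_iff, hcompat x]

end Summit.BirchSwinnertonDyer.Rank1Residual.JET.SelmerVocabulary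

end
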